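import Mathlib
import Summits.Schanuel.Schanuel.Theses.RigidCore

/-!
# Crux `MinimalCounterexampleInAcl` (stmt-Schanuel-0969), line `kernel-arithmetic-selection` —
# branch finiteness HOLDS at the defect-zero pair `(πi, π)` (small-model fact for `stub_branchFiniteness_rankTwo`)

Companion to `DefectZeroOffLog.lean` (`expImageFiniteOffLog_false_withLe`: at `x = (πi, π)` the mates
`((2k+1)πi, (2k+1)π)` have infinitely many exponential images, so exp-image finiteness with `trdeg ≤ n`
in place of `< n` is FALSE).  Here we record that the SAME witness does NOT refute the `≤`-weakening of
the rank-2 branch-finiteness stub: among the kernel translates `x + 2πik`, `k ∈ ℤ²`, of `x = (πi, π)`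
only `k = (0,0)` and `k = (−1,0)` lie on the ℚ-locus of `(x, eˣ)` — the relation `X₁² + X₂² = 0` of
`(πi, π)` evaluated at `(πi(1+2k₁), π + 2πik₂)` gives `π²(−(1+2k₁)² + (1+2ik₂)²) = 0`, i.e. `k₂ = 0`
and `k₁(k₁+1) = 0`.  So `branchFiniteness_rankTwo_withLe_holds_at_piPair`: the registered signature of
`stub_branchFiniteness_rankTwo` with `<` weakened to `≤`, INSTANTIATED at `(πi, π)`, is TRUE (the counted
set has at most two elements).  Drefute reading (gen 2): at rank 2, branch INfiniteness needs the fibre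
`W_y` to contain a rational line through a translate, i.e. (w.l.o.g.) `x₂` transcendental over
`ℚ(x₁, e^{x₁}, e^{x₂})` with `trdeg ℚ(x₁, e^{x₁}, e^{x₂}) ≤ 1`; every candidate is an open independence
statement (`(1, 1+πi)` ⟺ `e ⊥ π`, `(πi, πi + log 2)` ⟺ `π ⊥ log 2`), so — unlike for the exp-image stub —
no defect-zero refutation of the `≤`-version is available, and the rank-1 shadow `x = (2πi)`
(`locusMates_twoPiTuple_infinite`, `LocusMates.lean`) is the landed evidence that `trdeg < n` is
load-bearing for branch finiteness in general. [folklore]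
-/

noncomputable section

set_option linter.dupNamespace false

open Complex Set

namespace Summit.Schanuel.Schanuel.Theorems.MinimalCounterexampleInAcl.Negative

/-- `X₁² + X₂²` is a relation of `(πi, π, −1, e^π)`. -/
theorem aeval_sumSq_piPair :
    MvPolynomial.aeval (Sum.elim ![(Real.pi : ℂ) * I, (Real.pi : ℂ)]
        (Complex.exp ∘ ![(Real.pi : ℂ) * I, (Real.pi : ℂ)]))
      ((MvPolynomial.X (Sum.inl 0) : MvPolynomial (Fin 2 ⊕ Fin 2) ℚ) ^ 2 +
        MvPolynomial.X (Sum.inl 1) ^ 2) = 0 := by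
  simp only [map_add, map_pow, MvPolynomial.aeval_X, Sum.elim_inl, Matrix.cons_val_zero,
    Matrix.cons_val_one]
  linear_combination ((Real.pi : ℂ)) ^ 2 * Complex.I_sq

/-- **The kernel translates of `(πi, π)` on its ℚ-locus are `k = (0,0)` and `k = (−1,0)` only.**
If every ℚ-relation of `((πi, π), (−1, e^π))` holds at the translate `(πi + 2πik₀, π + 2πik₁)` (same
exponentials), then `k₁ = 0` and `k₀ ∈ {0, −1}` — read off from the single relation `X₁² + X₂²`. -/
theorem translate_mem_locusPts_piPair {k : Fin 2 → ℤ}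
    (hk : ∀ p : MvPolynomial (Fin 2 ⊕ Fin 2) ℚ,
      MvPolynomial.aeval (Sum.elim ![(Real.pi : ℂ) * I, (Real.pi : ℂ)]
        (Complex.exp ∘ ![(Real.pi : ℂ) * I, (Real.pi : ℂ)])) p = 0 →
      MvPolynomial.aeval (Sum.elim (fun i => ![(Real.pi : ℂ) * I, (Real.pi : ℂ)] i + 2 * ↑Real.pi * Complex.I * (k i : ℂ))
        (Complex.exp ∘ fun i => ![(Real.pi : ℂ) * I, (Real.pi : ℂ)] i + 2 * ↑Real.pi * Complex.I * (k i : ℂ))) p = 0) :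
    k 1 = 0 ∧ (k 0 = 0 ∨ k 0 = -1) := by
  have h := hk _ aeval_sumSq_piPair
  simp only [map_add, map_pow, MvPolynomial.aeval_X, Sum.elim_inl, Matrix.cons_val_zero,
    Matrix.cons_val_one] at h
  have hpi : (Real.pi : ℂ) ≠ 0 := by exact_mod_cast Real.pi_ne_zero
  have h2 : ((1 + 2 * (k 0 : ℂ)) * I) ^ 2 + (1 + 2 * (k 1 : ℂ) * I) ^ 2 = 0 := by
    have hfac : ((Real.pi : ℂ) * I + 2 * ↑Real.pi * I * (k 0 : ℂ)) ^ 2 +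
        ((Real.pi : ℂ) + 2 * ↑Real.pi * I * (k 1 : ℂ)) ^ 2 =
        (Real.pi : ℂ) ^ 2 * (((1 + 2 * (k 0 : ℂ)) * I) ^ 2 + (1 + 2 * (k 1 : ℂ) * I) ^ 2) := by ring
    rw [hfac] at h
    rcases mul_eq_zero.1 h with h | h
    · exact absurd ((pow_eq_zero_iff two_ne_zero).mp h) hpi
    · exact h
  have h3 : ((1 + 2 * (k 0 : ℂ)) * I) ^ 2 + (1 + 2 * (k 1 : ℂ) * I) ^ 2 =
      ((-(1 + 2 * k 0) ^ 2 + (1 - 4 * k 1 ^ 2) : ℤ) : ℂ) + ((4 * k 1 : ℤ) : ℂ) * I := by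
    push_cast
    linear_combination ((1 + 2 * (k 0 : ℂ)) ^ 2 + 4 * (k 1 : ℂ) ^ 2) * Complex.I_sq
  rw [h3] at h2
  have hre := congrArg Complex.re h2
  have him := congrArg Complex.im h2
  simp only [Complex.add_re, Complex.intCast_re, Complex.mul_re, Complex.I_re, mul_zero,
    Complex.intCast_im, Complex.I_im, mul_one, sub_zero, add_zero, Complex.zero_re,
    Complex.add_im, Complex.mul_im, zero_add, Complex.zero_im] at hre him
  have him' : 4 * k 1 = 0 := by exact_mod_cast him
  have hk1 : k 1 = 0 := by omega
  have hre' : -(1 + 2 * k 0) ^ 2 + (1 - 4 * k 1 ^ 2) = 0 := by exact_mod_cast hre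
  rw [hk1] at hre'
  refine ⟨hk1, ?_⟩
  have hprod : k 0 * (k 0 + 1) = 0 := by nlinarith
  rcases mul_eq_zero.1 hprod with h0 | h0
  · exact Or.inl h0
  · exact Or.inr (by omega)

/-- **Branch finiteness with `trdeg ≤ 2` HOLDS at `(πi, π)`.**  The set counted by
`stub_branchFiniteness_rankTwo` (kernel translates that are ℚ-linearly independent and on the ℚ-locus),
at `x = (πi, π)`, is contained in `{(0,0), (−1,0)}`, hence finite — although `x` satisfies the stub's
hypothesis only in the weakened form `trdeg ℚ(x, eˣ) ≤ 2` (`linearIndependent_realPair`,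
`trdeg_piPair_le_two` in `DefectZeroOffLog.lean`; in fact `= 2` by Nesterenko).  Contrast
`expImageFiniteOffLog_false_withLe` there (same `x`, infinitely many mate CLASSES). -/
theorem branchFiniteness_rankTwo_withLe_holds_at_piPair :
    {k : Fin 2 → ℤ | LinearIndependent ℚ (fun i => ![(Real.pi : ℂ) * I, (Real.pi : ℂ)] i + 2 * ↑Real.pi * Complex.I * (k i : ℂ)) ∧
      ∀ p : MvPolynomial (Fin 2 ⊕ Fin 2) ℚ,
        MvPolynomial.aeval (Sum.elim ![(Real.pi : ℂ) * I, (Real.pi : ℂ)]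
          (Complex.exp ∘ ![(Real.pi : ℂ) * I, (Real.pi : ℂ)])) p = 0 →
        MvPolynomial.aeval (Sum.elim (fun i => ![(Real.pi : ℂ) * I, (Real.pi : ℂ)] i + 2 * ↑Real.pi * Complex.I * (k i : ℂ))
          (Complex.exp ∘ fun i => ![(Real.pi : ℂ) * I, (Real.pi : ℂ)] i + 2 * ↑Real.pi * Complex.I * (k i : ℂ))) p = 0}.Finite := by
  refine (Set.toFinite ({![0, 0], ![-1, 0]} : Set (Fin 2 → ℤ))).subset ?_
  rintro k ⟨-, hk⟩
  obtain ⟨h1, h0 | h0⟩ := translate_mem_locusPts_piPair hk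
  · left
    funext i
    fin_cases i <;> simp [h0, h1]
  · right
    funext i
    fin_cases i <;> simp [h0, h1]

end Summit.Schanuel.Schanuel.Theorems.MinimalCounterexampleInAcl.Negative

end
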